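import Summits.QuantumFields.YangMills.Theses.FluxSectorLaplace
import HarnessLib

/-!
# Route `FluxSectorLaplace` (YangMills): the assembly item `Assembly` (stmt-QuantumFields-24083) holds BY NAME

`Assembly := FluxSectorSuppression → PeriodicCoreRaritySubQuartic → SectorDecomposition → SectorWeightMonotone →
  ToronSmallBall.ToronCoreRaritySubQuartic` — the eight-term sector bookkeeping: the slice-`0` thermal weight of the toron core
`{polDist ≤ β^(−γc)}` is `(1/8) Σ_z W_z(𝟙_CORE(U₀))` (SectorDecomposition); the untwisted term `z = 0` is `≤ β^(−a₂) Z(2L)`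
(PeriodicCoreRaritySubQuartic), each of the seven twisted terms is `≤ W_z(1) ≤ β^(−a₁) Z(2L)` (SectorWeightMonotone +
FluxSectorSuppression), so with `a = min a₁ a₂` the core weighs `≤ β^(−a) Z(2L)` on the common window.  The proof is the route's
own deciding theorem `FluxSectorLaplace.closes` (planner ym-idea-4 g13, gate-written with the route file); this file closes the
item by name.

HONEST FRAMING: bookkeeping; the cruxes `FluxSectorSuppression` (stmt-QuantumFields-24079) and `PeriodicCoreRaritySubQuartic`
(stmt-QuantumFields-24080) are OPEN, so `ToronCoreRaritySubQuartic` is NOT proved here; no summit conjunct is touched; the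
Yang–Mills mass gap is NOT proved.  No `sorry`, no new axiom, no new definition.
References: [cite: Luscher1983, §2]; [cite: tHooft1979].
-/

set_option autoImplicit false

namespace Summit.QuantumFields.YangMills.Theorems.FluxSectorLaplace

/-- **`Assembly` holds** (item stmt-QuantumFields-24083 of route `FluxSectorLaplace`, BY NAME):
`FluxSectorSuppression → PeriodicCoreRaritySubQuartic → SectorDecomposition → SectorWeightMonotone → ToronCoreRaritySubQuartic`,
the route's deciding theorem `closes`.  [cite: Luscher1983, §2] [cite: tHooft1979] -/
theorem assembly_proof :
    Summit.QuantumFields.YangMills.Theses.FluxSectorLaplace.Assembly :=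
  fun hF hP hD hM => Summit.QuantumFields.YangMills.Theses.FluxSectorLaplace.closes hF hP hD hM

end Summit.QuantumFields.YangMills.Theorems.FluxSectorLaplace
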